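import Literature.IUT.LogVolume.Corollary22CondP6Transport
import Literature.NumberTheory.DiophantineGeometry.FaltingsHeightIsogenyFiniteProofs
import Literature.NumberTheory.DiophantineGeometry.GenEllLemma35Proofs
import HarnessLib

/-!
# INV-EMBED cycle 2 (lens `embed`, seat abc-iut-inv-1) — the ISOGENY CARRIER is excluded or neutral

Crux workfile (record-only sketch, kernel-checked, 0 sorry) for the crux `ThetaPartII` = stmt-ABC-19678 of
route-ABC-IUTThetaPilot, RESHAPE-4 3177a83aca8d622d, remaining stub family
`Summit.ABC.ABC.Cruxes.ThetaPartII.InvEmbed.StubFamily` (= the `h312` binder of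
`Summit.ABC.ABC.Theorems.ThetaPartII_of_cor312PerImage`; gen-1 floor `InvEmbedParentFloor.lean`, sha16 51fb888c9ccbd8ce).
NO new route, NO item, NO side taken on [IUTchIII] Cor. 3.12 or on any author (D-0045); typed ≠ proved; NOT abc.

## What cycle 2 tests

Gen 1 (memo `INV-EMBED-NO-PARENT-inv-1.md` §7(a)) left ONE reopening condition for the lens: a theorem of a SETTLED
theory giving a real-valued inequality WITH EXPLICIT DISTORTION between invariants of two objects related by a
correspondence WEAKER than isomorphism. Such theorems exist, and the strongest one is IN THE TREE:
Faltings' isogeny lemma `WeierstrassCurve.stableFaltingsHeight_le_of_isogeny_holds`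
(`h(E') ≤ h(E) + ½·log deg φ` for an isogeny `φ : E → E'`; Faltings 1986 §3 Lemma 5). Its embed DICTIONARY is the one
the IUT literature itself names (the "global multiplicative subspace", GMS): Θ-link ↦ quotient `E → E/M` by a rank-one
subgroup `M ⊆ E[l]` multiplicative at every bad place; `q ↦ q^l` dilation ↦ the Θ-pilot; the `½·log l` distortion ↦ the
indeterminacies. [cite: arXiv:2004.13228, §5.4–5.6 pp. 17–20; LANA project report July 2026, §1.2 (∗) pp. 9–10]

## The carrier trichotomy (what this file checks)

Every bounded-distortion theorem needs a CARRIER (the weaker-than-iso correspondence). For the isogeny dictionary: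

* **(α) `F`-rational carrier — EXCLUDED by the crux's own hypothesis `(P6)`**, in tree:
  `EllPoint.not_admitsLCyclic_of_imageModLContainsSL2` and `Cor22.not_admitsLCyclic_of_condP6`
  (`SL₂(𝔽_l) ⊆` Galois image ⇒ no `Γ_F`-stable order-`l` subgroup ⇒ no `F`-isogeny of degree `l`,
  cf. `EllPoint.exists_isogeny_of_admitsLCyclic`). Section `Alpha` below only CERTIFIES THE NAMES.
* **(β) carrier over the splitting field `K = F(E[l])` — exactly NEUTRAL** (this file's kernel, Section `Beta`):
  `G = Gal(K/F)` acts on `X` = places of `K` above a bad place `v` and on `Y` = the `l + 1` lines of `E[l]`; the map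
  `μ : X → Y`, `w ↦` (multiplicative subspace at `w`), is `G`-equivariant, and `(P6)` makes `G` TRANSITIVE on `Y`
  (Section `Transitive`: `SL₂` moves the line of `e₁` to any line). Kernel facts: every line `M` is multiplicative at
  exactly `|X| / (l+1)` places above `v` (`card_fiber_mul_card`, the equal-fibre count DH state as "heuristically,
  probability `1/(l+1)`", p. 19); the quotient `E_K → E_K/M` dilates `ord_w(q)` by `l` where `M_w = μ(w)` and by `1/l`
  elsewhere (Tate uniformisation; (P2) `l ∤ ord_v(q)` only makes the second case integral after passing to `K`), so the
  place-averaged dilation is `(l + l·(1/l))/(l+1) = 1` EXACTLY (`dilation_sum_eq_card`): the normalised `q`-degree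
  of `E_K/M` equals that of `E`. Faltings' inequality specialises to an archimedean statement with no Diophantine
  (Szpiro) content; by the gen-1 floor `tameSzpiroSix_of_parent` it therefore cannot be an embed parent.
* **(δ) the prime-strip — EXISTS and BREAKS THE SYMMETRY** (`exists_mem_fiber`, `dilation_on_strip`): for every line
  `M` and every bad `v` some `w ∣ v` has `μ(w) = M` (DH Lemma 5.6.2 p. 20, kernel form), and on such a section the
  dilation is `l` at EVERY bad place — but a section of places is not a field, the product formula / Faltings' lemma no
  longer apply to it, and supplying a height theory for it ("simulating a GMS") is the disputed construction itself,
  i.e. carrier (γ) = a bounded-distortion identification ≡ the squeeze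
  (`Summit.ABC.ABC.Cruxes.ThetaPartII.IdentificationSocket.costumeLemma_holds`, census O-94).

Nothing here asserts anything about `μ`, `E[l]` or any curve: Sections `Beta`/`Transitive` are statements about finite
group actions and `2 × 2` matrices over a field; the dictionary above is documentation. [claim: Mochizuki2012, status: disputed]
-/

set_option linter.dupNamespace false

noncomputable section

namespace Summit.ABC.ABC.Cruxes.ThetaPartII.InvEmbed.Isogeny

open Finset

/-! ## Section Alpha — (α) is in the tree: name certification only -/
section Alpha

open Literature.NumberTheory.DiophantineGeometry.GenEll Literature.NumberTheory.DiophantineGeometry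

/-- (α): `SL₂(𝔽_l) ⊆ image ⇒ no Γ_F-stable order-l subgroup of E[l]` — tree theorem, cited by name. -/
example (P : EllPoint) (l : ℕ) [Fact l.Prime] (h : P.ImageModLContainsSL2 l) : ¬ P.AdmitsLCyclic l :=
  EllPoint.not_admitsLCyclic_of_imageModLContainsSL2 P l h

/-- (α) at the crux's hypothesis `Cor22.CondP6` (every model over every Galois `F'/F_tpd` with `l ∤ [F':F_tpd]`). -/
example := @Literature.IUT.LogVolume.Cor22.not_admitsLCyclic_of_condP6

/-- The `F`-rational carrier an `l`-cyclic subgroup WOULD give: an `F`-isogeny of degree `l` (tree). -/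
example := @EllPoint.exists_isogeny_of_admitsLCyclic

/-- F1 of the §7(a) table: Faltings' isogeny lemma, PROVED in the tree (the bounded-distortion theorem). -/
example : WeierstrassCurve.stableFaltingsHeight_le_of_isogeny :=
  WeierstrassCurve.stableFaltingsHeight_le_of_isogeny_holds

end Alpha

/-! ## Section Beta — equivariant maps onto a transitive set have equal fibres; the dilation average is 1 -/
section Beta

variable {G X Y : Type*} [Group G] [MulAction G X] [MulAction G Y] [Fintype X] [Fintype Y]
  [DecidableEq X] [DecidableEq Y]

/-- The fibre of `φ` over `y` (dictionary: the places `w ∣ v` of `K` at which the line `y ⊆ E[l]` is the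
multiplicative subspace). -/
def fiber (φ : X → Y) (y : Y) : Finset X := Finset.univ.filter (fun x => φ x = y)

omit [DecidableEq X] [Fintype Y] in
theorem mem_fiber {φ : X → Y} {y : Y} {x : X} : x ∈ fiber φ y ↔ φ x = y := by
  simp [fiber]

omit [DecidableEq X] [Fintype Y] in
/-- Translating a fibre by `g` lands in the fibre over `g • y`, injectively. -/
theorem card_fiber_le (φ : X → Y) (hφ : ∀ (g : G) (x : X), φ (g • x) = g • φ x) (g : G) (y : Y) :
    (fiber φ y).card ≤ (fiber φ (g • y)).card := by
  refine Finset.card_le_card_of_injOn (fun x => g • x) ?_ ?_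
  · intro x hx
    have hx' : φ x = y := by simpa [fiber] using hx
    simp [fiber, hφ, hx']
  · intro x₁ _ x₂ _ h
    exact (smul_left_cancel_iff g).1 h

omit [DecidableEq X] [Fintype Y] in
/-- **Equal fibres.** If `G` is transitive on `Y`, all fibres of an equivariant `φ : X → Y` have the same size. -/
theorem card_fiber_eq (φ : X → Y) (hφ : ∀ (g : G) (x : X), φ (g • x) = g • φ x)
    (hY : ∀ y y' : Y, ∃ g : G, g • y = y') (y y' : Y) :
    (fiber φ y).card = (fiber φ y').card := by
  obtain ⟨g, rfl⟩ := hY y y'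
  obtain ⟨g', hg'⟩ := hY (g • y) y
  refine le_antisymm (card_fiber_le φ hφ g y) ?_
  calc (fiber φ (g • y)).card ≤ (fiber φ (g' • g • y)).card := card_fiber_le φ hφ g' (g • y)
    _ = (fiber φ y).card := by rw [hg']

omit [DecidableEq X] in
/-- **The `1/(l+1)` law, exactly.** `#fibre · #Y = #X` for every fibre (DH p. 19 "heuristically, probability
`1/(l+1)`" is an identity once `(P6)` gives transitivity on the `l+1` lines). -/
theorem card_fiber_mul_card (φ : X → Y) (hφ : ∀ (g : G) (x : X), φ (g • x) = g • φ x)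
    (hY : ∀ y y' : Y, ∃ g : G, g • y = y') (y : Y) :
    (fiber φ y).card * Fintype.card Y = Fintype.card X := by
  have h1 : Fintype.card X = ∑ y' : Y, (fiber φ y').card := by
    rw [← Finset.card_univ, Finset.card_eq_sum_ones, ← Finset.sum_fiberwise Finset.univ φ (fun _ => 1)]
    refine Finset.sum_congr rfl (fun y' _ => ?_)
    rw [← Finset.card_eq_sum_ones]
    rfl
  rw [h1, Finset.sum_congr rfl (fun y' _ => card_fiber_eq φ hφ hY y' y), Finset.sum_const, Finset.card_univ,
    smul_eq_mul, mul_comm]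

omit [DecidableEq X] in
/-- Fibrewise evaluation of a sum over `X` of a function of `φ x`. -/
theorem sum_comp_eq_sum_card_mul (φ : X → Y) (f : Y → ℝ) :
    ∑ x : X, f (φ x) = ∑ y : Y, ((fiber φ y).card : ℝ) * f y := by
  rw [← Finset.sum_fiberwise Finset.univ φ (fun x => f (φ x))]
  refine Finset.sum_congr rfl (fun y _ => ?_)
  have : ∀ x ∈ Finset.univ.filter (fun x => φ x = y), f (φ x) = f y := by
    intro x hx
    rw [(Finset.mem_filter.1 hx).2]
  rw [Finset.sum_congr rfl this, Finset.sum_const, nsmul_eq_mul]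
  rfl

omit [DecidableEq X] in
/-- **Neutrality of the isogeny carrier (β).** With `#Y = l + 1` (the lines of `E[l]`), a dilation profile
`δ` equal to `l` on the distinguished line `M` and to `1/l` on the other `l` lines (quotient by `M`:
`ord_w(q_{E/M}) = l·ord_w(q_E)` if `M` is the multiplicative subspace at `w`, `= ord_w(q_E)/l` otherwise) has
place-sum EXACTLY `#X`: the averaged dilation is `1`, the normalised `q`-degree is unchanged. -/
theorem dilation_sum_eq_card (φ : X → Y) (hφ : ∀ (g : G) (x : X), φ (g • x) = g • φ x)
    (hY : ∀ y y' : Y, ∃ g : G, g • y = y') {l : ℕ} (hl : 0 < l) (hcard : Fintype.card Y = l + 1)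
    (M : Y) (δ : Y → ℝ) (hM : δ M = l) (hoff : ∀ y, y ≠ M → δ y = (l : ℝ)⁻¹) :
    ∑ x : X, δ (φ x) = Fintype.card X := by
  rw [sum_comp_eq_sum_card_mul φ δ]
  have hc : ∀ y, ((fiber φ y).card : ℝ) = (fiber φ M).card := fun y => by
    exact_mod_cast card_fiber_eq φ hφ hY y M
  simp_rw [hc]
  rw [← Finset.mul_sum]
  have hsum : ∑ y : Y, δ y = (l : ℝ) + 1 := by
    rw [← Finset.add_sum_erase Finset.univ δ (Finset.mem_univ M), hM]
    have h2 : ∀ y ∈ Finset.univ.erase M, δ y = (l : ℝ)⁻¹ := fun y hy => hoff y (Finset.ne_of_mem_erase hy)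
    rw [Finset.sum_congr rfl h2, Finset.sum_const, nsmul_eq_mul, Finset.card_erase_of_mem (Finset.mem_univ M),
      Finset.card_univ, hcard]
    have hl' : (l : ℝ) ≠ 0 := by exact_mod_cast hl.ne'
    simp [hl']
  rw [hsum]
  have hX := card_fiber_mul_card φ hφ hY M
  rw [hcard] at hX
  exact_mod_cast hX

omit [DecidableEq X] in
/-- The same with the concrete profile `if y = M then l else l⁻¹`. -/
theorem dilation_sum_eq_card' (φ : X → Y) (hφ : ∀ (g : G) (x : X), φ (g • x) = g • φ x)
    (hY : ∀ y y' : Y, ∃ g : G, g • y = y') {l : ℕ} (hl : 0 < l) (hcard : Fintype.card Y = l + 1) (M : Y) :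
    ∑ x : X, (if φ x = M then (l : ℝ) else (l : ℝ)⁻¹) = Fintype.card X :=
  dilation_sum_eq_card φ hφ hY hl hcard M (fun y => if y = M then (l : ℝ) else (l : ℝ)⁻¹) (by simp)
    (fun y hy => by simp [hy])

omit [DecidableEq X] in
/-- Weighted form (all places above `v` carry the same weight `c = [K_w : ℚ_p]·ord_w(q_E)` as `K/F` is Galois):
the `M`-quotient's weighted `q`-degree above `v` equals `E`'s. -/
theorem weighted_dilation_sum_eq (φ : X → Y) (hφ : ∀ (g : G) (x : X), φ (g • x) = g • φ x)
    (hY : ∀ y y' : Y, ∃ g : G, g • y = y') {l : ℕ} (hl : 0 < l) (hcard : Fintype.card Y = l + 1) (M : Y)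
    (c : ℝ) :
    ∑ x : X, c * (if φ x = M then (l : ℝ) else (l : ℝ)⁻¹) = ∑ _x : X, c := by
  rw [← Finset.mul_sum, dilation_sum_eq_card' φ hφ hY hl hcard M, Finset.sum_const, Finset.card_univ,
    nsmul_eq_mul, mul_comm]

/-! ## Section Delta — the prime-strip exists (DH Lemma 5.6.2, kernel form) and has dilation `l` everywhere -/

omit [Fintype X] [Fintype Y] [DecidableEq X] [DecidableEq Y] in
/-- **(δ) existence of the symmetry-breaking section.** Over every bad place (`X` nonempty) every line `M` IS the
multiplicative subspace at some `w ∣ v` — transitivity on `Y` and equivariance, nothing else. -/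
theorem exists_mem_fiber [Nonempty X] (φ : X → Y) (hφ : ∀ (g : G) (x : X), φ (g • x) = g • φ x)
    (hY : ∀ y y' : Y, ∃ g : G, g • y = y') (M : Y) : ∃ x : X, φ x = M := by
  obtain ⟨x₀⟩ := ‹Nonempty X›
  obtain ⟨g, hg⟩ := hY (φ x₀) M
  exact ⟨g • x₀, by rw [hφ, hg]⟩

omit [Fintype X] [Fintype Y] [DecidableEq X] [Group G] [MulAction G X] [MulAction G Y] in
/-- On the section ("prime-strip") the dilation is `l` at every chosen place — versus the Galois average `1`
(`dilation_sum_eq_card`): the factor `l` is bought exactly by leaving the Galois-symmetric (field) setting. -/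
theorem dilation_on_strip (φ : X → Y) {l : ℕ} (M : Y) (x : X) (hx : φ x = M) :
    (if φ x = M then (l : ℝ) else (l : ℝ)⁻¹) = l := by
  simp [hx]

end Beta

/-! ## Section Transitive — why `(P6)` gives the transitivity used in Section Beta -/
section Transitive

variable {K : Type*} [Field K]

/-- `SL₂(K)` moves `e₁` to any nonzero vector: for `v ≠ 0` there is a determinant-one matrix `A` with
`A e₁ = v`; hence (with `(P6)`: every determinant-one endomorphism of `E[l]` is a Galois element) `Gal(K/F)` is
transitive on the `l+1` lines of `E[l]` — hypothesis `hY` of Section Beta. -/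
theorem exists_det_one_mulVec_eq (v : Fin 2 → K) (hv : v ≠ 0) :
    ∃ A : Matrix (Fin 2) (Fin 2) K, A.det = 1 ∧ A.mulVec ![1, 0] = v := by
  by_cases h0 : v 0 = 0
  · have h1 : v 1 ≠ 0 := by
      intro h1
      apply hv
      ext i
      fin_cases i <;> simp [h0, h1]
    refine ⟨!![0, -(v 1)⁻¹; v 1, 0], ?_, ?_⟩
    · simp [Matrix.det_fin_two_of, h1]
    · ext i
      fin_cases i <;> simp [Matrix.mulVec, dotProduct, Fin.sum_univ_two, h0]
  · refine ⟨!![v 0, 0; v 1, (v 0)⁻¹], ?_, ?_⟩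
    · simp [Matrix.det_fin_two_of, h0]
    · ext i
      fin_cases i <;> simp [Matrix.mulVec, dotProduct, Fin.sum_univ_two]

/-- (α) in one line of linear algebra (the tree's proof of `not_admitsLCyclic_of_imageModLContainsSL2` in
coordinates): a line `K·(a,b)` stable under BOTH elementary transvections `(a,b) ↦ (a+b,b)` and `(a,b) ↦ (a,a+b)`
is zero — two determinant-one Galois elements already forbid an `F`-rational order-`l` subgroup. -/
theorem eq_zero_of_stable_under_transvections {a b : K}
    (hU : ∃ c : K, a + b = c * a ∧ b = c * b) (hL : ∃ c : K, a = c * a ∧ a + b = c * b) :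
    a = 0 ∧ b = 0 := by
  obtain ⟨c, hc1, hc2⟩ := hU
  obtain ⟨d, hd1, hd2⟩ := hL
  have hb : b = 0 := by
    by_contra hb
    have hc : c = 1 := by
      have : (c - 1) * b = 0 := by rw [sub_mul, one_mul, ← hc2, sub_self]
      rcases mul_eq_zero.1 this with h | h
      · exact (sub_eq_zero.1 h)
      · exact absurd h hb
    rw [hc, one_mul] at hc1
    exact hb (by simpa using hc1)
  subst hb
  refine ⟨?_, rfl⟩
  simpa using hd2

end Transitive

end Summit.ABC.ABC.Cruxes.ThetaPartII.InvEmbed.Isogeny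

end
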